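import Summits.ResolutionOfSingularities.ResolutionOfSingularities.Theorems.BoundaryLedgerClasses
import Literature.AlgebraicGeometry.Resolution.PointBlowupShadeCentres
import Literature.AlgebraicGeometry.Resolution.WeightedBlowupNoIncrease
import Literature.AlgebraicGeometry.Resolution.OrdZeroBasics
import HarnessLib

/-!
# JumpCutModel — §1 of lens-3 g13 «JumpCut» rev 2 (sha256 0a503d388e12867c; decomp-res node N70, critic row 89
MAP delta (a))

THE MODEL LAW, VERBATIM: `not_shadeIncreases_of_ordZero_eq` = Hauser–Perlega 2019 §3 Theorem (2) «w ≥ 2» at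
`c = q = pᵉ` for EVERY `e` and
every number of variables — at `ord₀ F = q`, cleaned `F`, `r ≤ supp F`, a centre `b` with `b_j = 0` that is
EQUIMULTIPLE admits no shade
increase (proof by a partial translation; characteristic enters only through the tree's
`necessary_of_shadeIncreases_pow` (iii));
`two_mul_le_ordZero_of_shadeIncreases_pow` (a jump at `q = pᵉ` needs `2q ≤ ord₀ F`: census I56's heavy-parent
law as a theorem);
`orderMultipleCondition_of_shadeIncreases` (the tree predicate `OrderMultipleCondition (p^e)` derived).  Used by
`Theorems.JumpCutClasses`
(module docstring there = the node).  0 sorry.  [WRITER NOTE (decomp-res writer g5): verbatim split; imports = the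
lens's Literature imports.]
(Sources: HauserPerlega2019 §3 Theorem (2), (3); Moh1987; Hauser2010 §D.)
-/

open MvPolynomial Finset
open Literature.AlgebraicGeometry.Resolution
open Literature.AlgebraicGeometry.Resolution.Hauser2010
open Literature.AlgebraicGeometry.Resolution.PointBlowup

namespace Summit.ResolutionOfSingularities.ResolutionOfSingularities.Theorems.JumpCut

/-! ## §1 The model law: no shade increase at order exactly `q = pᵉ` (Hauser–Perlega (2) at `c = pᵉ`) -/

section Model

variable {σ : Type*} {K : Type*} [Field K] [Fintype σ] [DecidableEq σ] [DecidableEq K]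

omit [Fintype σ] [DecidableEq σ] [DecidableEq K] in
/-- Translations compose: `(P(y + b))(y + a) = P(y + (b + a))`. [folklore] -/
theorem translate_translate (a b : σ → K) (P : MvPolynomial σ K) :
    translate a (translate b P) = translate (fun i => b i + a i) P := by
  unfold PointBlowup.translate
  rw [← AlgHom.comp_apply, MvPolynomial.comp_aeval]
  have h : (fun i => aeval (fun i => (X i + C (a i) : MvPolynomial σ K))
      (X i + C (b i) : MvPolynomial σ K)) = fun i => (X i + C (b i + a i) : MvPolynomial σ K) := by
    funext i
    simp only [map_add, aeval_X, algHom_C, algebraMap_eq]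
    ring
  rw [h]

variable (p : ℕ) [hp : Fact p.Prime] [CharP K p]

/-- **No kangaroo at order exactly `q` (Hauser–Perlega 2019 §3 Theorem (2) at `c = q = pᵉ`, every `e`, every
dimension, in the point-blowup model).**  If `F` is cleaned of `q`-th powers, `ord₀ F = q` exactly, the
exceptional multiplicities divide every monomial (`r ≤ d` on `supp F`), the centre `b` of the next chart `y_j` is
an EQUIMULTIPLE point (`ord ≥ q` persists after the blowup) with `b_j = 0`, then the shade does NOT increase.
Proof (new; characteristic enters only through `necessary_of_shadeIncreases_pow` (iii)): a jump loses an
exceptional component `i₀ ≠ j` (`b_{i₀} ≠ 0 ≠ r_{i₀}`), so `y_{i₀}` divides `F`; the `y_j`-free layer of the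
point transform is `T = G₀(y + b)` with `G₀` the initial form read in the chart; equimultiplicity makes every
non-constant monomial of `T` an initial monomial `y^D` of `F` with `D_j = 0`; `T` is not constant (translate
back: `G₀ = T(y − b)` has the monomial `χ(d₀)` with positive `i₀`-exponent); `D ≠ q·e_{i₀}` (cleaned), so some
`i₁ ≠ i₀` has `D_{i₁} ≥ 1`; now translate `T` by `−b_{i₀}` in the `i₀`-direction only: the result is
`G₀(y + b⁰)` with `b⁰_{i₀} = 0`, every monomial of which keeps `i₀`-exponent `≥ 1` — yet its coefficient at
`D − D_{i₀} e_{i₀}` computed from `T` is `coeff_D(T) · (−b_{i₀})^{D_{i₀}} ≠ 0`. (Sources: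
HauserPerlega2019PRIMS, §3 Theorem (2); Hauser2010, §G Kangaroo Theorem (2).) -/
theorem not_shadeIncreases_of_ordZero_eq {e : ℕ} (j : σ) (b : σ → K) (hbj : b j = 0) (s : State σ K)
    (hclean : deletePthPowers (p ^ e) s.F = s.F) (ho : ordZero s.F = ((p ^ e : ℕ) : ℕ∞))
    (hr : ∀ d ∈ s.F.support, s.r ≤ d) (heq : IsEquimultiplePoint (p ^ e) j b s) :
    ¬ ShadeIncreases (p ^ e) j b s := by
  classical
  intro hinc
  -- (1) a jump loses an exceptional component `i₀ ≠ j` with `b i₀ ≠ 0`, `r i₀ ≠ 0` (HP2019 (3) at c = q)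
  obtain ⟨-, -, i₀, hi₀j, hbi₀, hri₀, -⟩ :=
    necessary_of_shadeIncreases_pow p j b hbj s hclean ho le_rfl hr hinc
  have hFi₀ : ∀ d ∈ s.F.support, 1 ≤ d i₀ := fun d hd =>
    (Nat.one_le_iff_ne_zero.mpr hri₀).trans (Finsupp.le_def.mp (hr d hd) i₀)
  have hdeg : ∀ d ∈ s.F.support, p ^ e ≤ d.degree := le_degree_of_ordZero_eq s ho
  -- the initial exponents of F and the initial form read in the chart `y_j`
  set I : Finset (σ →₀ ℕ) := s.F.support.filter (fun d => d.degree = p ^ e) with hI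
  have hIF : ∀ d ∈ I, d ∈ s.F.support := fun d hd => (Finset.mem_filter.mp hd).1
  have hIdeg : ∀ d ∈ I, d.degree = p ^ e := fun d hd => (Finset.mem_filter.mp hd).2
  set G₀ : MvPolynomial σ K := ∑ d ∈ I, monomial (chartExponent (p ^ e) j d) (coeff d s.F) with hG₀
  have hχj : ∀ d ∈ I, chartExponent (p ^ e) j d j = 0 := fun d hd => by
    rw [chartExponent_apply, if_pos rfl, hIdeg d hd, Nat.sub_self]
  have hχi : ∀ (d : σ →₀ ℕ) (i : σ), i ≠ j → chartExponent (p ^ e) j d i = d i := fun d i hi => by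
    rw [chartExponent_apply, if_neg hi]
  have hχdeg : ∀ d ∈ I, (chartExponent (p ^ e) j d).degree + d j = p ^ e := fun d hd => by
    have h1 := degree_eq_add_sum_erase j (chartExponent (p ^ e) j d)
    have h2 := degree_eq_add_sum_erase j d
    have h3 : ∑ i ∈ univ.erase j, chartExponent (p ^ e) j d i = ∑ i ∈ univ.erase j, d i :=
      Finset.sum_congr rfl fun i hi => hχi d i (Finset.ne_of_mem_erase hi)
    rw [hχj d hd, h3] at h1
    have h4 := hIdeg d hd
    omega
  have hinj : ∀ d ∈ I, ∀ d' ∈ I, chartExponent (p ^ e) j d = chartExponent (p ^ e) j d' → d = d' :=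
    fun d hd d' hd' h => chartExponent_injective (hIdeg d hd).ge (hIdeg d' hd').ge h
  have hcoeffG₀ : ∀ d ∈ I, coeff (chartExponent (p ^ e) j d) G₀ = coeff d s.F := fun d hd =>
    coeff_sum_monomial_of_injOn I (chartExponent (p ^ e) j) (fun d => coeff d s.F) hd
      fun x hx _ h => hinj x hx d hd h
  have hsuppG₀ : ∀ E ∈ G₀.support, ∃ d ∈ I, chartExponent (p ^ e) j d = E := fun E hE => by
    obtain ⟨d, hd, -, h⟩ :=
      exists_of_mem_support_sum_monomial I (chartExponent (p ^ e) j) (fun d => coeff d s.F) hE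
    exact ⟨d, hd, h⟩
  -- (2) the `y_j`-free layer of the point transform is `translate b G₀`
  have hlayer : ∀ E : σ →₀ ℕ, E j = 0 →
      coeff E (pointTransform (p ^ e) j b s) = coeff E (translate b G₀) := by
    intro E hEj
    rw [pointTransform_eq_sum, coeff_sum]
    have hrhs : coeff E (translate b G₀) =
        ∑ d ∈ I, coeff E (translate b (monomial (chartExponent (p ^ e) j d) (coeff d s.F))) := by
      rw [hG₀]
      unfold PointBlowup.translate
      rw [map_sum, coeff_sum]
    rw [hrhs, hI, Finset.sum_filter]
    refine Finset.sum_congr rfl fun d hd => ?_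
    by_cases hdp : d.degree = p ^ e
    · rw [if_pos hdp]
    · rw [if_neg hdp]
      by_contra hne
      have h1 := apply_eq_of_coeff_translate_monomial_ne_zero b hbj hne
      rw [hEj, chartExponent_apply, if_pos rfl] at h1
      have h2 := hdeg d hd
      omega
  -- (3) every NON-ZERO exponent of `T := translate b G₀` is an initial exponent of F with vanishing j-component
  have hTmem : ∀ D ∈ (translate b G₀).support, D ≠ 0 → D ∈ I ∧ D j = 0 := by
    intro D hD hD0
    obtain ⟨E', hE', hle⟩ := exists_le_of_mem_support_translate b G₀ hD
    obtain ⟨d, hd, rfl⟩ := hsuppG₀ E' hE'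
    have hDj : D j = 0 := by
      have := Finsupp.le_def.mp hle j
      rw [hχj d hd] at this
      omega
    have hDT : coeff D (translate b G₀) ≠ 0 := MvPolynomial.mem_support_iff.mp hD
    have hDq : p ^ e ≤ D.degree := by
      by_contra hlt
      rw [not_le] at hlt
      exact hDT (by rw [← hlayer D hDj]; exact heq D hD0 hlt)
    have hDeq : D = chartExponent (p ^ e) j d := by
      by_contra hne
      have hlt := degree_lt_degree_of_lt (lt_of_le_of_ne hle hne)
      have := hχdeg d hd
      omega
    have hdj : d j = 0 := by
      have h1 := hχdeg d hd
      have h2 := degree_le_degree_of_le hle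
      omega
    have hχd : chartExponent (p ^ e) j d = d := by
      ext i
      by_cases hi : i = j
      · rw [hi, hχj d hd, hdj]
      · exact hχi d i hi
    refine ⟨?_, hDj⟩
    rw [hDeq, hχd]
    exact hd
  -- (4) `T` is not a constant
  obtain ⟨D, hDT, hD0⟩ : ∃ D ∈ (translate b G₀).support, D ≠ 0 := by
    obtain ⟨⟨d₀, hd₀c, hd₀deg⟩, -⟩ := (ordZero_eq_nat_iff s.F (p ^ e)).mp ho
    have hd₀F : d₀ ∈ s.F.support := MvPolynomial.mem_support_iff.mpr hd₀c
    have hd₀I : d₀ ∈ I := by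
      rw [hI]
      exact Finset.mem_filter.mpr ⟨hd₀F, hd₀deg⟩
    have hne : coeff (chartExponent (p ^ e) j d₀) (translate (fun i => -b i) (translate b G₀)) ≠ 0 := by
      rw [translate_neg_translate, hcoeffG₀ d₀ hd₀I]
      exact hd₀c
    obtain ⟨D, hD, hle⟩ := exists_le_of_mem_support_translate (fun i => -b i) (translate b G₀)
      (MvPolynomial.mem_support_iff.mpr hne)
    refine ⟨D, hD, fun hD0 => ?_⟩
    have h1 : 1 ≤ chartExponent (p ^ e) j d₀ i₀ := by
      rw [hχi d₀ i₀ hi₀j]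
      exact hFi₀ d₀ hd₀F
    have h2 := Finsupp.le_def.mp hle i₀
    rw [hD0, Finsupp.coe_zero, Pi.zero_apply] at h2
    omega
  obtain ⟨hDI, -⟩ := hTmem D hDT hD0
  have hDF : D ∈ s.F.support := hIF D hDI
  have hDdeg : D.degree = p ^ e := hIdeg D hDI
  -- (5) `D ≠ q·e_{i₀}` since F is cleaned: a second index carries a positive exponent
  obtain ⟨i₁, hi₁, hDi₁⟩ : ∃ i₁, i₁ ≠ i₀ ∧ D i₁ ≠ 0 := by
    by_contra hall
    push Not at hall
    refine not_isPthPowerExponent_of_clean (p ^ e) hclean hDF ((isPthPowerExponent_iff (p ^ e) D).mpr ?_)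
    intro i
    by_cases hi : i = i₀
    · rw [hi]
      have h1 := degree_eq_add_sum_erase i₀ D
      have h2 : ∑ k ∈ univ.erase i₀, D k = 0 :=
        Finset.sum_eq_zero fun k hk => hall k (Finset.ne_of_mem_erase hk)
      rw [h2, add_zero, hDdeg] at h1
      exact h1 ▸ dvd_rfl
    · rw [hall i hi]
      exact dvd_zero _
  -- (6) the partial translation in the `i₀`-direction
  obtain ⟨E₀, hE₀i₀, hE₀i⟩ : ∃ E₀ : σ →₀ ℕ, E₀ i₀ = 0 ∧ ∀ i, i ≠ i₀ → E₀ i = D i :=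
    ⟨Finsupp.erase i₀ D, Finsupp.erase_same, fun i hi => Finsupp.erase_ne hi⟩
  obtain ⟨c, hci₀, hci⟩ : ∃ c : σ → K, c i₀ = -b i₀ ∧ ∀ i, i ≠ i₀ → c i = 0 :=
    ⟨fun i => if i = i₀ then -b i₀ else 0, if_pos rfl, fun i hi => if_neg hi⟩
  -- Way 1: `translate c T = translate (b + c) G₀` with `(b + c) i₀ = 0`; its `E₀`-coefficient vanishes
  have hzero : coeff E₀ (translate (fun i => b i + c i) G₀) = 0 := by
    rw [translate_eq_sum_support (fun i => b i + c i) G₀, coeff_sum]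
    refine Finset.sum_eq_zero fun E' hE' => ?_
    obtain ⟨d, hd, rfl⟩ := hsuppG₀ E' hE'
    refine WeightedBlowup.coeff_translate_monomial_eq_zero_of_apply_eq_zero _ _ _ _ (i := i₀) ?_ ?_
    · show b i₀ + c i₀ = 0
      rw [hci₀, add_neg_cancel]
    · rw [hE₀i₀, hχi d i₀ hi₀j]
      exact hFi₀ d (hIF d hd)
  -- Way 2: computed from `T`, only the monomial `y^D` of `T` contributes to that coefficient
  have hmain : coeff E₀ (translate c (monomial D (coeff D (translate b G₀)))) ≠ 0 := by
    rw [WeightedBlowup.coeff_translate_monomial]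
    refine mul_ne_zero (MvPolynomial.mem_support_iff.mp hDT) (Finset.prod_ne_zero_iff.mpr fun i _ => ?_)
    by_cases hi : i = i₀
    · rw [hi, hE₀i₀, Nat.choose_zero_right, Nat.cast_one, one_mul, hci₀, Nat.sub_zero]
      exact pow_ne_zero _ (neg_ne_zero.mpr hbi₀)
    · rw [hE₀i i hi, Nat.choose_self, Nat.cast_one, one_mul, hci i hi, Nat.sub_self, pow_zero]
      exact one_ne_zero
  have hothers : ∀ D' ∈ (translate b G₀).support, D' ≠ D →
      coeff E₀ (translate c (monomial D' (coeff D' (translate b G₀)))) = 0 := by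
    intro D' hD' hD'D
    by_cases hD'0 : D' = 0
    · exact WeightedBlowup.coeff_translate_monomial_eq_zero_of_lt c D' E₀ _ (i := i₁)
        (by rw [hD'0, Finsupp.coe_zero, Pi.zero_apply, hE₀i i₁ hi₁]; exact Nat.pos_of_ne_zero hDi₁)
    · obtain ⟨hD'I, -⟩ := hTmem D' hD' hD'0
      obtain ⟨i, hi, hne⟩ : ∃ i, i ≠ i₀ ∧ D' i ≠ D i := by
        by_contra hall
        push Not at hall
        apply hD'D
        ext i
        by_cases hi : i = i₀
        · have h1 := degree_eq_add_sum_erase i₀ D'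
          have h2 := degree_eq_add_sum_erase i₀ D
          have h3 : ∑ k ∈ univ.erase i₀, D' k = ∑ k ∈ univ.erase i₀, D k :=
            Finset.sum_congr rfl fun k hk => hall k (Finset.ne_of_mem_erase hk)
          have h4 := hIdeg D' hD'I
          rw [h3] at h1
          rw [hi]
          omega
        · exact hall i hi
      rcases lt_or_gt_of_ne hne with hlt | hgt
      · exact WeightedBlowup.coeff_translate_monomial_eq_zero_of_lt c D' E₀ _ (i := i)
          (by rw [hE₀i i hi]; exact hlt)
      · exact WeightedBlowup.coeff_translate_monomial_eq_zero_of_apply_eq_zero c D' E₀ _ (hci i hi)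
          (by rw [hE₀i i hi]; exact hgt)
  have hne : coeff E₀ (translate c (translate b G₀)) ≠ 0 := by
    rw [translate_eq_sum_support c (translate b G₀), coeff_sum,
      Finset.sum_eq_single D hothers (fun h => absurd hDT h)]
    exact hmain
  exact hne (by rw [translate_translate]; exact hzero)

/-- **HP2019 (2) "`o = w·c`, `w ≥ 2`" at `c = q = pᵉ` in the model, as the strengthened Moh-type bound
`2q ≤ ord₀ F` at every shade increase (all `e`; the tree had it for `e = 1` only,
`PointBlowup.two_mul_le_ordZero_of_shadeIncreases`).** (Sources: HauserPerlega2019PRIMS, §3 Theorem (2).) -/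
theorem two_mul_le_ordZero_of_shadeIncreases_pow {e : ℕ} (j : σ) (b : σ → K) (hbj : b j = 0) (s : State σ K)
    (hclean : deletePthPowers (p ^ e) s.F = s.F) {o : ℕ} (ho : ordZero s.F = o) (hqo : p ^ e ≤ o)
    (hr : ∀ d ∈ s.F.support, s.r ≤ d) (hinc : ShadeIncreases (p ^ e) j b s)
    (heq : IsEquimultiplePoint (p ^ e) j b s) : 2 * p ^ e ≤ o := by
  obtain ⟨⟨w, hw⟩, -, -⟩ := necessary_of_shadeIncreases_pow p j b hbj s hclean ho hqo hr hinc
  have hq : 0 < p ^ e := pow_pos hp.out.pos e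
  rcases Nat.lt_or_ge w 2 with hlt | hge
  · interval_cases w
    · omega
    · rw [mul_one] at hw
      rw [hw] at ho
      exact absurd hinc (not_shadeIncreases_of_ordZero_eq p j b hbj s hclean ho hr heq)
  · calc 2 * p ^ e ≤ w * p ^ e := Nat.mul_le_mul_right _ hge
      _ = o := by rw [hw, mul_comm]

/-- The typed literature predicate: **kangaroo ⇒ (2)** at `c = pᵉ`. (Sources: HauserPerlega2019PRIMS, §3 Theorem (2).) -/
theorem orderMultipleCondition_of_shadeIncreases {e : ℕ} (j : σ) (b : σ → K) (hbj : b j = 0) (s : State σ K)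
    (hclean : deletePthPowers (p ^ e) s.F = s.F) {o : ℕ} (ho : ordZero s.F = o) (hqo : p ^ e ≤ o)
    (hr : ∀ d ∈ s.F.support, s.r ≤ d) (hinc : ShadeIncreases (p ^ e) j b s)
    (heq : IsEquimultiplePoint (p ^ e) j b s) : HauserPerlega2019.OrderMultipleCondition (p ^ e) s.F := by
  obtain ⟨⟨w, hw⟩, -, -⟩ := necessary_of_shadeIncreases_pow p j b hbj s hclean ho hqo hr hinc
  have h2 := two_mul_le_ordZero_of_shadeIncreases_pow p j b hbj s hclean ho hqo hr hinc heq
  have hq : 0 < p ^ e := pow_pos hp.out.pos e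
  refine ⟨w, ?_, by rw [ho, hw, mul_comm]⟩
  by_contra hlt
  rw [not_le] at hlt
  have : w * p ^ e < 2 * p ^ e := Nat.mul_lt_mul_of_pos_right hlt hq
  rw [hw] at h2
  rw [mul_comm] at this
  omega

end Model

end Summit.ResolutionOfSingularities.ResolutionOfSingularities.Theorems.JumpCut
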